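import Mathlib
import Summits.ValiantsHypothesis.ValiantsHypothesis.Theorems.DivisionGapPerMultiplesHardDeepCount
import Summits.ValiantsHypothesis.ValiantsHypothesis.Theorems.DivisionGapPerMultiplesHardStubFaceDescent
import Literature.Computability.AlgebraicComplexity.ArithCircuitProofs
import Literature.Computability.AlgebraicComplexity.PermanentIrreducible

/-!
# `DivisionGap.PerMultiplesHard` (stmt-ValiantsHypothesis-5068), line `uncharged-face-walk`:
support avoidance at every depth (registered rung `supportAvoidanceDeep`)

If a nonzero multiplier `h ∈ ℝ≥0[x_ij]` involves no variable of a graph `G ⊆ [n]²` containing a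
perfect matching, then the multiple `per_n · h` is at least as hard as the face permanent `per_G`
counted at depth `D`:

  `#PM(G) · 3^{D n} ≤ (L⁺(per_n · h) + 2)^{2^D - 1} · n! · (n+1)^{2^D - 1} · 2^{D(n - ⌊n/3⌋) + 4D2^D}`

for every `D ≥ 1` and `n ≥ 3^{D+1}`.  Mechanism: the indicator weight of `G` cuts out `G`
(`cutsOut_indicator`), every top-fibre exponent of `h` avoids `G`, so the fibre has the single
`G`-part `u = 0`; the landed face descent (`FaceDescent.stub_faceDescent`) gives
`L⁺(per_G) ≤ L⁺(per_n · h) + 1`, and the landed deep count (`DeepCount.richFacesDeepD`) bounds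
`#PM(G)`.  This is the walk run to its natural end (`offFace_rung` of the skeleton) at depth `D`;
with M. Hall / van der Waerden counts for `#PM(K ∖ V)` it is the card's `SparseMultiplesHard` at
every constant matching density. [cite: JerrumSnir1982, §3–§4.3]
-/

noncomputable section

open MvPolynomial Literature.Computability.AlgebraicComplexity
open scoped NNReal BigOperators
open Summit.ValiantsHypothesis.ValiantsHypothesis.Theorems.ZeroOneTransfer.Negative
open Summit.ValiantsHypothesis.ValiantsHypothesis.Theorems.DivisionGap.PerMultiplesHard

namespace Summit.ValiantsHypothesis.ValiantsHypothesis.Theorems.DivisionGap.PerMultiplesHard.SupportAvoidanceDeep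

variable {n : ℕ}

/-- The indicator weight of a graph containing a perfect matching cuts out that graph: a
permutation lies inside `G` iff its weight (the number of its cells inside `G`) is maximal.
[folklore] -/
theorem cutsOut_indicator (G : Finset (Fin n × Fin n))
    (hG : ∃ σ : Equiv.Perm (Fin n), ∀ i, (σ i, i) ∈ G) (σ : Equiv.Perm (Fin n)) :
    (∀ i, (σ i, i) ∈ G) ↔ ∀ τ : Equiv.Perm (Fin n),
      (∑ i, (if (τ i, i) ∈ G then 1 else 0 : ℕ)) ≤ ∑ i, (if (σ i, i) ∈ G then 1 else 0 : ℕ) := by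
  classical
  have hcount : ∀ τ : Equiv.Perm (Fin n),
      (∑ i, (if (τ i, i) ∈ G then 1 else 0 : ℕ)) =
        ((Finset.univ : Finset (Fin n)).filter fun i => (τ i, i) ∈ G).card := fun τ =>
    Finset.sum_boole _ _
  have hle : ∀ τ : Equiv.Perm (Fin n), (∑ i, (if (τ i, i) ∈ G then 1 else 0 : ℕ)) ≤ n := by
    intro τ
    rw [hcount]
    exact (Finset.card_filter_le _ _).trans (by rw [Finset.card_univ, Fintype.card_fin])
  have hfull : ∀ τ : Equiv.Perm (Fin n), (∀ i, (τ i, i) ∈ G) →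
      (∑ i, (if (τ i, i) ∈ G then 1 else 0 : ℕ)) = n := by
    intro τ hτ
    rw [hcount, Finset.filter_true_of_mem (fun i _ => hτ i), Finset.card_univ, Fintype.card_fin]
  obtain ⟨σ₀, hσ₀⟩ := hG
  constructor
  · intro hσ τ
    rw [hfull σ hσ]
    exact hle τ
  · intro hmax i
    have h1 : n ≤ ∑ i, (if (σ i, i) ∈ G then 1 else 0 : ℕ) := by
      have := hmax σ₀
      rwa [hfull σ₀ hσ₀] at this
    have h2 : ((Finset.univ : Finset (Fin n)).filter fun i => (σ i, i) ∈ G) = Finset.univ := by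
      apply Finset.eq_univ_of_card
      rw [Fintype.card_fin]
      exact le_antisymm ((hcount σ) ▸ hle σ) ((hcount σ) ▸ h1)
    have h3 : i ∈ ((Finset.univ : Finset (Fin n)).filter fun i => (σ i, i) ∈ G) := by
      rw [h2]; exact Finset.mem_univ i
    exact (Finset.mem_filter.mp h3).2

/-- **supportAvoidanceDeep (registered rung of line `uncharged-face-walk`).**  For `D ≥ 1`,
`n ≥ 3^{D+1}`, a graph `G ⊆ [n]²` with a perfect matching and a nonzero multiplier `h` none of
whose exponents touches `G`:
`#PM(G) · 3^{D n} ≤ (L⁺(per_n · h) + 2)^{2^D - 1} · n! · (n+1)^{2^D - 1} · 2^{D(n - ⌊n/3⌋) + 4D2^D}`.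
Face descent along the indicator weight of `G` (single `G`-part `0`) followed by the deep count.
[cite: JerrumSnir1982, §3–§4.3] -/
theorem supportAvoidanceDeep : ∀ (D : ℕ), 1 ≤ D → ∀ (n : ℕ), 3 ^ (D + 1) ≤ n →
    ∀ (G : Finset (Fin n × Fin n)) (h : MvPolynomial (Fin n × Fin n) ℝ≥0), h ≠ 0 →
      (∀ m ∈ h.support, ∀ e ∈ m.support, e ∉ G) →
      (∃ σ : Equiv.Perm (Fin n), ∀ i, (σ i, i) ∈ G) →
      ((Finset.univ : Finset (Equiv.Perm (Fin n))).filter (fun σ => ∀ i, (σ i, i) ∈ G)).card *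
          3 ^ (D * n) ≤
        (complexity (perPoly (Fin n) ℝ≥0 * h) + 2) ^ (2 ^ D - 1) *
          (n.factorial * ((n + 1) ^ (2 ^ D - 1) * 2 ^ (D * (n - n / 3) + 4 * D * 2 ^ D))) := by
  intro D hD n hn G h hh hv hG
  classical
  set perG : MvPolynomial (Fin n × Fin n) ℝ≥0 :=
    ∑ σ ∈ (Finset.univ : Finset (Equiv.Perm (Fin n))).filter (fun σ => ∀ i, (σ i, i) ∈ G),
      monomial (permMonomial σ) (1 : ℝ≥0) with hperG
  -- the top fibre of `h` along the indicator weight has the single `G`-part `0`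
  have hsingle : (0 : (Fin n × Fin n) →₀ ℕ).support ⊆ G ∧
      ∀ m ∈ (topComponent (fun e => if e ∈ G then 1 else 0) h).support, ∀ e ∈ G,
        m e = (0 : (Fin n × Fin n) →₀ ℕ) e := by
    refine ⟨by simp, fun m hm e he => ?_⟩
    have hm' : m ∈ h.support := support_topComponent_subset _ h hm
    rw [Finsupp.coe_zero, Pi.zero_apply]
    by_contra hne
    exact hv m hm' e (Finsupp.mem_support_iff.mpr hne) he
  have hdesc : complexity (monomial (0 : (Fin n × Fin n) →₀ ℕ) (1 : ℝ≥0) * perG) ≤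
      complexity (perPoly (Fin n) ℝ≥0 * h) + 1 :=
    FaceDescent.stub_faceDescent n G (fun e => if e ∈ G then 1 else 0) h 0
      (cutsOut_indicator G hG) hh hsingle
  have h1 : monomial (0 : (Fin n × Fin n) →₀ ℕ) (1 : ℝ≥0) * perG = perG := by
    rw [← MvPolynomial.C_apply (R := ℝ≥0) (σ := Fin n × Fin n) (a := 1)]
    simp
  rw [h1] at hdesc
  have hle : complexity perG + 1 ≤ complexity (perPoly (Fin n) ℝ≥0 * h) + 2 := by omega
  calc _ ≤ (complexity perG + 1) ^ (2 ^ D - 1) *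
        (n.factorial * ((n + 1) ^ (2 ^ D - 1) * 2 ^ (D * (n - n / 3) + 4 * D * 2 ^ D))) :=
        DeepCount.richFacesDeepD D hD n hn G
    _ ≤ _ := Nat.mul_le_mul_right _ (Nat.pow_le_pow_left hle _)

end Summit.ValiantsHypothesis.ValiantsHypothesis.Theorems.DivisionGap.PerMultiplesHard.SupportAvoidanceDeep

end
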